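import Mathlib.Tactic.Ring
import HarnessLib

/-!
# Venture HSemireg — the MECHANISM of THEOREM 2g for general g (ENGINE-W code A, SERVICE (α), RUNG 3 (i); note P5-ALPHA-MOMENT-A.md v1.8 §2 (F) (i)–(iii)):
# for commuting `x = π`, `y = π̄` and the slopes `k_a = x^a y^b` (`a + b = s = g − 1`, conjugate `k̄_a = y^a x^b`), the three identities that collapse D2's
# `(g+1)² − 4` moment conditions to `n − 1` rational equations: the SIGN PAIR (odd `p + q` dies), the DIAGONAL (`|k_a|^{2p}` is `a`-independent), and the
# ANTISYMMETRIC PAIRING `k_a^p k̄_a^q − k_b^p k̄_b^q = (xy)^{sq+bm}·(x^{(a−b)m} − y^{(a−b)m})` for `p = q + m`, `a = b + j` — general ring identities with symbolic exponents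

HONEST FRAMING. Lean index of the computation cell `pub-hsemireg`, widening group ENGINE-W (code A, seat `engine-w-1`, gen 18).
POLYNOMIAL ∕ POWER-LAW IDENTITIES ONLY (any commutative ring, natural-number exponents as parameters). What is NOT formalised: the linear-algebra count «n − 1 equations in n unknowns have a
non-zero solution», rationality of (x^r − y^r)∕(x − y), abelian varieties, D2's criterion (by value), or anything object-level; nothing here says that HC, HC_CM, HC_AV or DIAG(n,d) holds.
Theorems only (0 `def`, 0 named fact, 0 `sorry`). New namespace `TwoGSlopeMechanism`. Companions: `TwoGSlopeDesignFour.lean` (#51; g = 4 with explicit weights, 23 identities),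
`SplitPrimeMomentDesign.lean` (#50), `SingleOrbitMomentRule.lean` (#49).

SOURCE (the cell's own result, by value): `widen/ENGINE-W/out/p5alpha/P5-ALPHA-MOMENT-A.md` v1.8 §2 (F) «(i) M_{p,q}(𝔇) = 0 for p + q odd (the ± pairs); (ii) M_{p,p}(𝔇) = 0 for all p
(|k_a|^{2p} = N^{sp} is a-independent and Σ w_a = 0); (iii) for p − q = m ≠ 0 even, M_{p,q}(𝔇) = 2N^{sq}·Σ_{a>s∕2} w_a N^{(s−a)m}(π^{(2a−s)m} − π̄^{(2a−s)m}) … PROOF … k_a^p k̄_a^q =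
π^{ap+(s−a)q}π̄^{(s−a)p+aq}, exponent difference (2a−s)m, and pairing a ↔ s−a with w_{s−a} = −w_a gives N^{min}(π^{(2a−s)m} − π̄^{(2a−s)m}) with min exponent sq + (s−a)m». What the kernel holds
(write `a = b + j` for the upper index and its partner `b`, `s = a + b`, `p = q + m`):

* `sign_pair` — `k^p k̄^q + (−k)^p (−k̄)^q = (1 + (−1)^(p+q))·k^p k̄^q` (so the `±` copies kill odd `p + q` and double even `p + q`).
* `diagonal` — `(x^a y^b)^p (y^a x^b)^p = ((x y)^(a+b))^p` (a-independent ⇒ with `Σ_a w_a = 0` every diagonal moment vanishes).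
* `moment_monomial` — `(x^a y^b)^(q+m) (y^a x^b)^q = (x y)^((a+b)·q) · (x^(a m) · y^(b m))`.
* `antisymmetric_pairing` — `(x^(b+j) y^b)^(q+m) (y^(b+j) x^b)^q − (x^b y^(b+j))^(q+m) (y^b x^(b+j))^q = (x y)^((2b+j)·q + b·m) · (x^(j m) − y^(j m))`:
  the upper slope `a = b + j` minus its partner `b` leaves `N^{sq + bm}·(x^{jm} − y^{jm})` (`N = xy`, `s = 2b + j`, `b = s − a`) — the single m-dependent factor of (iii).
-/

namespace Summit.Ventures.HSemireg.TwoGSlopeMechanism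

/-- **Sign pair**: `k^p k̄^q + (−k)^p(−k̄)^q = (1 + (−1)^(p+q))·k^p k̄^q`. [kernel, `ring`] -/
theorem sign_pair {R : Type*} [CommRing R] (k kb : R) (p q : ℕ) :
    k ^ p * kb ^ q + (-k) ^ p * (-kb) ^ q = (1 + (-1) ^ (p + q)) * (k ^ p * kb ^ q) := by
  have h1 : (-k) ^ p = (-1) ^ p * k ^ p := by rw [← mul_pow, neg_one_mul]
  have h2 : (-kb) ^ q = (-1) ^ q * kb ^ q := by rw [← mul_pow, neg_one_mul]
  rw [h1, h2, pow_add]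
  ring

/-- **Odd `p + q`**: the sign pair vanishes. [kernel] -/
theorem sign_pair_odd {R : Type*} [CommRing R] (k kb : R) (p q : ℕ) (h : Odd (p + q)) :
    k ^ p * kb ^ q + (-k) ^ p * (-kb) ^ q = 0 := by
  rw [sign_pair, Odd.neg_one_pow h]
  ring

/-- **Diagonal**: `(x^a y^b)^p (y^a x^b)^p = ((xy)^(a+b))^p` — independent of how `s = a + b` is split. [kernel, `ring`] -/
theorem diagonal {R : Type*} [CommRing R] (x y : R) (a b p : ℕ) :
    (x ^ a * y ^ b) ^ p * (y ^ a * x ^ b) ^ p = ((x * y) ^ (a + b)) ^ p := by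
  ring

/-- **Moment monomial**: `(x^a y^b)^(q+m) (y^a x^b)^q = (xy)^((a+b)q) · x^(am) · y^(bm)`. [kernel, `ring`] -/
theorem moment_monomial {R : Type*} [CommRing R] (x y : R) (a b q m : ℕ) :
    (x ^ a * y ^ b) ^ (q + m) * (y ^ a * x ^ b) ^ q = (x * y) ^ ((a + b) * q) * (x ^ (a * m) * y ^ (b * m)) := by
  ring

/-- **Antisymmetric pairing** (the heart of (iii)): for the upper slope `a = b + j` and its partner `b` (`s = 2b + j`), at `p = q + m`:
`k_a^p k̄_a^q − k_b^p k̄_b^q = (xy)^(s q + b m) · (x^(j m) − y^(j m))`. [kernel, `ring`] -/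
theorem antisymmetric_pairing {R : Type*} [CommRing R] (x y : R) (b j q m : ℕ) :
    (x ^ (b + j) * y ^ b) ^ (q + m) * (y ^ (b + j) * x ^ b) ^ q - (x ^ b * y ^ (b + j)) ^ (q + m) * (y ^ b * x ^ (b + j)) ^ q
      = (x * y) ^ ((2 * b + j) * q + b * m) * (x ^ (j * m) - y ^ (j * m)) := by
  ring

/-- **Assembly of one antisymmetric pair with its sign copies**: with weight `w` on `±k_a` and `−w` on `±k_b` (`a = b + j`), the contribution to `M_{q+m, q}` is
`(1 + (−1)^m)·w·(xy)^(sq + bm)·(x^(jm) − y^(jm))` (note `(−1)^(p+q) = (−1)^m` as `p + q = 2q + m`). [kernel] -/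
theorem pair_contribution {R : Type*} [CommRing R] (x y w : R) (b j q m : ℕ) :
    w * ((x ^ (b + j) * y ^ b) ^ (q + m) * (y ^ (b + j) * x ^ b) ^ q + (-(x ^ (b + j) * y ^ b)) ^ (q + m) * (-(y ^ (b + j) * x ^ b)) ^ q)
      - w * ((x ^ b * y ^ (b + j)) ^ (q + m) * (y ^ b * x ^ (b + j)) ^ q + (-(x ^ b * y ^ (b + j))) ^ (q + m) * (-(y ^ b * x ^ (b + j))) ^ q)
      = (1 + (-1) ^ m) * w * ((x * y) ^ ((2 * b + j) * q + b * m) * (x ^ (j * m) - y ^ (j * m))) := by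
  rw [sign_pair, sign_pair, ← antisymmetric_pairing]
  have hm : ((-1 : R)) ^ (q + m + q) = (-1) ^ m := by
    rw [show q + m + q = m + 2 * q by ring, pow_add, pow_mul]
    norm_num
  rw [hm]
  ring

end Summit.Ventures.HSemireg.TwoGSlopeMechanism
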